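import Summits.QuantumFields.BalabanUV.Beta.CompositeVertexKernelBoundsTwo

/-!
# `BalabanUV.Beta.CompositeVertexKernelBoundsTwoSym` — row D1 ∕ (C1), file F5c (supplement to F5b): THE ROOTED-SYMMETRISED INSTANTIATION of the
# composite second-order border family — the brick SYMMETRISED IN THE TWO BACKGROUND BONDS,
# `𝓋₂^{rs} m μ y g g₁ g₂ := ½ (vh2KerAt (toSite (r m)) L μ y g g₁ g₂ + vh2KerAt (toSite (r m)) L μ y g g₂ g₁)`

WHY (located).  leaf-02 g29's R-17 (INTENT-17, journal l.55922) pairs R-8's `hsucc₂` against `H ⊗ H′`, which forces the second brick symmetrised in the two background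
bonds; the record's own border table one step down is the same symmetrisation (`SecondOrderSocketIdentification.vh₂SAn1 = atw (½ • (vh₂SAt ρ_c … κ u κ′ u′ + vh₂SAt ρ_c … κ′ u′ κ u))`,
`SymSecondOrderTablesAn1.symVh₂SAn1` likewise).  F5a∕F5b are BRICK-GENERIC, so this is an INSTANTIATION, not a re-cut (W-an2-g51-3, l.55992): F5b's `Rooted` section is the
RAW-table instance; this file names the symmetrised one.  §1 the brick and its three letters (support in each slot, bound `≤ B₂` from `vh2Abs`, block covariance); §2 ANCHOR
**`compVH2Ker_rootedSym_one`** (kernel) and **`compVh2S_rootedSym_one`**: `compVh2S … 1 κ u κ′ u′ = ½ • (vh₂SAt (toSite (r 0)) L κ u κ′ u′ + vh₂SAt (toSite (r 0)) L κ′ u′ κ u)` (the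
stencil-level symmetrisation); §3 (LB) `locStencil₂_compVh2S_rootedSym` (same constant as the raw instance), (TB) `compVh2S_rootedSym_translate`; §4 (v1.1, gen 52) THE
«SYMSYM» INSTANTIATION — an1's (0.4)-SYMMETRISED bricks at ONE root with the second brick symmetrised in the two background bonds, `symVh2KerSymAt ρ L := ½(symVh2KerAt ρ L … g g₁ g₂ + … g g₂ g₁)`
(the re-based tower's order-2 one-step brick under RULING R-D1-g52-1 (β1) = leaf-02's Q-leaf02-g30-1 answered (P)): letters, anchors `compVH2Ker_symSym_one`,
**`compVh2S_symSym_one : compVh2S … 1 κ u κ′ u′ = ½ • (symVh₂SAt (toSite r) L κ u κ′ u′ + symVh₂SAt (toSite r) L κ′ u′ κ u)`** (the (0.4) record's row table `symVh₂SAn1 = atw` of exactly this at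
`toSite r = ctr`), (LB) with an1's `symVh2Abs` (one root — no uniformity hypothesis), (TB).
[folklore] BY NAME over F5a∕F5b's generic letters and an1's `vh2KerAt_add ∕ vh2Tab_eq_zero₁₂₃ ∕ abs_vh2Tab_le`; ONE [our object — bookkeeping] abbreviation (`vh2KerSymAt`, the
symmetrised brick; v1.1 adds its sym twin `symVh2KerSymAt`); nothing of Bałaban's asserted, valued or discharged; 0 estimates; 0∕4 row-D1 binders; NOT (C1), NOT D1, NEVER «G-an2-4 closed», NOT BetaPertH, NOT continuum, NOT Clay.

HONEST DEPENDENCY (page 1, mandatory): continuum YM on T⁴ ⇐ BetaPertH ∧ nine spine estimates (0/9 proved); BetaPertH ⇐ (D1) ∧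
(D4) ∧ CAP+tail; G-an2-4 gates asym, D1 and NE2/3/4.  Row D1 ∕ (C1) OWNER an2, gen 51 ∕ 52 (§4), 2026-08-23 ∕ 24.  No existing file touched.
-/

noncomputable section

open scoped BigOperators

namespace Summit.QuantumFields.BalabanUV.Beta.CompositeVertexKernelBoundsTwoSym

open Finset
open Literature.MathematicalPhysics.QuantumFieldTheory.Balaban1983to89
open Literature.MathematicalPhysics.QuantumFieldTheory.Balaban1983to89.Beta
open AffineAveraging (Site box toSite)
open AveragingContours (blk off)
open AveragingHessianKernels (Bond Near packVH ell)
open AveragingHessianKernelsRooted (linKerAt vhKerAt)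
open AveragingMixedJetTables (vh2KerAt vh₂SAt vh2Abs)
open ExpKernelCalculus (MKer BiLoc shiftK)
open OneStepResolventKernel (Fib)
open BalabanCompositeJets (LocStencil₂)
open Summit.QuantumFields.BalabanUV.Beta.CompositeVertexKernelRec (wid bndVH2 compVH2Ker compVh2S compVH2Ker_one locStencil₂_compVh2S compVh2S_translate)

variable {d : ℕ}

/-! ## §1 The symmetrised rooted second brick and its letters -/

/-- [our object — bookkeeping] **THE ROOTED SECOND BRICK SYMMETRISED IN THE TWO BACKGROUND BONDS**:
`vh2KerSymAt ρ L μ y g g₁ g₂ := ½ (vh2KerAt ρ L μ y g g₁ g₂ + vh2KerAt ρ L μ y g g₂ g₁)`. -/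
def vh2KerSymAt (ρ : Site (d + 1)) (L : ℕ) (μ : Fin (d + 1)) (y : Site (d + 1)) (g g₁ g₂ : Bond (d + 1)) : ℝ :=
  (1 / 2 : ℝ) * (vh2KerAt ρ L μ y g g₁ g₂ + vh2KerAt ρ L μ y g g₂ g₁)

/-- [folklore] unfolding. -/
theorem vh2KerSymAt_apply (ρ : Site (d + 1)) (L : ℕ) (μ : Fin (d + 1)) (y : Site (d + 1)) (g g₁ g₂ : Bond (d + 1)) :
    vh2KerSymAt ρ L μ y g g₁ g₂ = (1 / 2 : ℝ) * (vh2KerAt ρ L μ y g g₁ g₂ + vh2KerAt ρ L μ y g g₂ g₁) := rfl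

/-- [folklore] The symmetrised brick is symmetric in the two background bonds. -/
theorem vh2KerSymAt_swap (ρ : Site (d + 1)) (L : ℕ) (μ : Fin (d + 1)) (y : Site (d + 1)) (g g₁ g₂ : Bond (d + 1)) :
    vh2KerSymAt ρ L μ y g g₂ g₁ = vh2KerSymAt ρ L μ y g g₁ g₂ := by
  rw [vh2KerSymAt, vh2KerSymAt, add_comm]

variable {L : ℕ} {r : ℕ → (Fin (d + 1) → ℕ)}

/-- [folklore] support in the fluctuation bond (box root). -/
theorem vh2KerSymAt_eq_zero₁ (hr : ∀ k, r k ∈ box (d + 1) L) (m : ℕ) (μ : Fin (d + 1)) (y : Site (d + 1)) {g : Bond (d + 1)}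
    (h : ¬ Near L y g.2) (g₁ g₂ : Bond (d + 1)) : vh2KerSymAt (toSite (r m)) L μ y g g₁ g₂ = 0 := by
  have e1 : vh2KerAt (toSite (r m)) L μ y g g₁ g₂ = 0 := by
    show ((AveragingMixedJetTables.vh2Tab (toSite (r m)) L μ y g g₁ g₂ : ℚ) : ℝ) = 0
    rw [AveragingMixedJetTables.vh2Tab_eq_zero₁ (hr m) μ y h g₁ g₂, Rat.cast_zero]
  have e2 : vh2KerAt (toSite (r m)) L μ y g g₂ g₁ = 0 := by
    show ((AveragingMixedJetTables.vh2Tab (toSite (r m)) L μ y g g₂ g₁ : ℚ) : ℝ) = 0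
    rw [AveragingMixedJetTables.vh2Tab_eq_zero₁ (hr m) μ y h g₂ g₁, Rat.cast_zero]
  rw [vh2KerSymAt, e1, e2, add_zero, mul_zero]

/-- [folklore] support in the first background bond (box root). -/
theorem vh2KerSymAt_eq_zero₂ (hr : ∀ k, r k ∈ box (d + 1) L) (m : ℕ) (μ : Fin (d + 1)) (y : Site (d + 1)) (g : Bond (d + 1)) {g₁ : Bond (d + 1)}
    (h : ¬ Near L y g₁.2) (g₂ : Bond (d + 1)) : vh2KerSymAt (toSite (r m)) L μ y g g₁ g₂ = 0 := by
  have e1 : vh2KerAt (toSite (r m)) L μ y g g₁ g₂ = 0 := by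
    show ((AveragingMixedJetTables.vh2Tab (toSite (r m)) L μ y g g₁ g₂ : ℚ) : ℝ) = 0
    rw [AveragingMixedJetTables.vh2Tab_eq_zero₂ (hr m) μ y g h g₂, Rat.cast_zero]
  have e2 : vh2KerAt (toSite (r m)) L μ y g g₂ g₁ = 0 := by
    show ((AveragingMixedJetTables.vh2Tab (toSite (r m)) L μ y g g₂ g₁ : ℚ) : ℝ) = 0
    rw [AveragingMixedJetTables.vh2Tab_eq_zero₃ (hr m) μ y g g₂ h, Rat.cast_zero]
  rw [vh2KerSymAt, e1, e2, add_zero, mul_zero]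

/-- [folklore] support in the second background bond (box root). -/
theorem vh2KerSymAt_eq_zero₃ (hr : ∀ k, r k ∈ box (d + 1) L) (m : ℕ) (μ : Fin (d + 1)) (y : Site (d + 1)) (g g₁ : Bond (d + 1)) {g₂ : Bond (d + 1)}
    (h : ¬ Near L y g₂.2) : vh2KerSymAt (toSite (r m)) L μ y g g₁ g₂ = 0 := by
  rw [← vh2KerSymAt_swap]
  exact vh2KerSymAt_eq_zero₂ hr m μ y g h g₁

/-- [folklore] the bound: `|𝓋₂^{rs}| ≤ B₂` whenever `vh2Abs (toSite (r m)) L ≤ B₂` at every level. -/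
theorem abs_vh2KerSymAt_le (hr : ∀ k, r k ∈ box (d + 1) L) {B₂ : ℝ} (hB₂b : ∀ m, vh2Abs (toSite (r m)) L ≤ B₂) (m : ℕ) (μ : Fin (d + 1))
    (y : Site (d + 1)) (g g₁ g₂ : Bond (d + 1)) : |vh2KerSymAt (toSite (r m)) L μ y g g₁ g₂| ≤ B₂ := by
  have h1 := (AveragingMixedJetTables.abs_vh2Tab_le (hr m) μ y g g₁ g₂).trans (hB₂b m)
  have h2 := (AveragingMixedJetTables.abs_vh2Tab_le (hr m) μ y g g₂ g₁).trans (hB₂b m)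
  rw [vh2KerSymAt, abs_mul, abs_of_pos (by norm_num : (0 : ℝ) < 1 / 2)]
  have h3 := abs_add_le (vh2KerAt (toSite (r m)) L μ y g g₁ g₂) (vh2KerAt (toSite (r m)) L μ y g g₂ g₁)
  have e1 : |vh2KerAt (toSite (r m)) L μ y g g₁ g₂| ≤ B₂ := h1
  have e2 : |vh2KerAt (toSite (r m)) L μ y g g₂ g₁| ≤ B₂ := h2
  linarith

/-- [folklore] block covariance of the symmetrised brick (an1's `vh2KerAt_add` twice). -/
theorem vh2KerSymAt_add (ρ : Site (d + 1)) (L : ℕ) (μ : Fin (d + 1)) (y t : Site (d + 1)) (g g₁ g₂ : Bond (d + 1)) :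
    vh2KerSymAt ρ L μ (y + t) (g.sh ((L : ℤ) • t)) (g₁.sh ((L : ℤ) • t)) (g₂.sh ((L : ℤ) • t)) = vh2KerSymAt ρ L μ y g g₁ g₂ := by
  rw [vh2KerSymAt, vh2KerSymAt, AveragingMixedJetTables.vh2KerAt_add, AveragingMixedJetTables.vh2KerAt_add]

/-! ## §2 Anchor -/

/-- [folklore] (RS) ANCHOR: over an1's rooted bricks with the second brick symmetrised, the depth-one composite second-order border kernel IS the
symmetrised brick at level `0`. -/
theorem compVH2Ker_rootedSym_one (hr : ∀ k, r k ∈ box (d + 1) L) (μ : Fin (d + 1)) (y : Site (d + 1)) (f b b' : Bond (d + 1)) :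
    compVH2Ker (fun m => linKerAt (toSite (r m)) L) (fun m => vhKerAt (toSite (r m)) L) (fun m => vh2KerSymAt (toSite (r m)) L) L 1 μ y f b b'
      = vh2KerSymAt (toSite (r 0)) L μ y f b b' :=
  compVH2Ker_one (fun m μ y _ g' g'' h => vh2KerSymAt_eq_zero₁ hr m μ y h g' g'')
    (fun m μ y g _ g'' h => vh2KerSymAt_eq_zero₂ hr m μ y g h g'') (fun m μ y g g' _ h => vh2KerSymAt_eq_zero₃ hr m μ y g g' h) μ y f b b'

/-- [folklore] **(RS) ANCHOR AT THE STENCIL LEVEL — THE STENCIL-LEVEL SYMMETRISATION**: the depth-one packed family IS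
`½ • (vh₂SAt (toSite (r 0)) L κ u κ′ u′ + vh₂SAt (toSite (r 0)) L κ′ u′ κ u)` (node 7a's packer closes over the FIRST background bond, so exchanging the two
background bonds of the brick exchanges the two bond indices of the packed family). -/
theorem compVh2S_rootedSym_one (hr : ∀ k, r k ∈ box (d + 1) L) (κ : Fin (d + 1)) (u : Site (d + 1)) (κ' : Fin (d + 1)) (u' : Site (d + 1)) :
    compVh2S (fun m => linKerAt (toSite (r m)) L) (fun m => vhKerAt (toSite (r m)) L) (fun m => vh2KerSymAt (toSite (r m)) L) L 1 κ u κ' u'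
      = (1 / 2 : ℝ) • (vh₂SAt (toSite (r 0)) L κ u κ' u' + vh₂SAt (toSite (r 0)) L κ' u' κ u) := by
  funext x z a b
  have e : ∀ (μ : Fin (d + 1)) (y : Site (d + 1)) (f f' : Bond (d + 1)),
      compVH2Ker (fun m => linKerAt (toSite (r m)) L) (fun m => vhKerAt (toSite (r m)) L) (fun m => vh2KerSymAt (toSite (r m)) L) L 1 μ y f (κ, u) f'
        = (1 / 2 : ℝ) * (vh2KerAt (toSite (r 0)) L μ y f (κ, u) f' + vh2KerAt (toSite (r 0)) L μ y f f' (κ, u)) :=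
    fun μ y f f' => compVH2Ker_rootedSym_one hr μ y f (κ, u) f'
  simp only [compVh2S, pow_one, Pi.smul_apply, Pi.add_apply, smul_eq_mul, AveragingMixedJetTables.vh₂SAt]
  rcases a with α | μ <;> rcases b with α' | μ'
  · simp only [AveragingHessianKernels.packVH_inl_inl, add_zero, mul_zero]
  · simp only [AveragingHessianKernels.packVH_inl_inr]
    split_ifs with h
    · exact e μ' (blk L z) (α, x) (κ', u')
    · rw [add_zero, mul_zero]
  · simp only [AveragingHessianKernels.packVH_inr_inl]
    split_ifs with h
    · exact e μ (blk L x) (α', z) (κ', u')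
    · rw [add_zero, mul_zero]
  · simp only [AveragingHessianKernels.packVH_inr_inr, add_zero, mul_zero]

/-! ## §3 (LB) and (TB) -/

/-- [folklore] (RS) (LB): the symmetrised-brick composite second-order family at blocking `L^m` has the `LocStencil₂` body at every rate, same constant as
the raw instance (`|½(a + b)| ≤ B₂`). -/
theorem locStencil₂_compVh2S_rootedSym (hL : 1 ≤ L) (hr : ∀ k, r k ∈ box (d + 1) L) {B₂ : ℝ} (hB₂ : 0 ≤ B₂)
    (hB₂b : ∀ m, vh2Abs (toSite (r m)) L ≤ B₂) (m : ℕ) {δ : ℝ} (hδ : 0 ≤ δ) :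
    LocStencil₂ (compVh2S (fun m => linKerAt (toSite (r m)) L) (fun m => vhKerAt (toSite (r m)) L) (fun m => vh2KerSymAt (toSite (r m)) L) L m)
      (bndVH2 d L (ell (d + 1) L : ℝ) (3 * (ell (d + 1) L : ℝ) ^ 2) B₂ m * Real.exp (3 * ((d : ℝ) + 1) * (wid L m) * δ)) δ :=
  locStencil₂_compVh2S (ℓ := fun m => linKerAt (toSite (r m)) L) (𝓋 := fun m => vhKerAt (toSite (r m)) L)
    (𝓋₂ := fun m => vh2KerSymAt (toSite (r m)) L) hL (by positivity) (by positivity) hB₂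
    (fun m μ y f => AveragingHessianKernelsRooted.abs_linKerAt_le hL μ y (hr m) f)
    (fun m μ y f f' => AveragingHessianKernelsRooted.abs_vhKerAt_le hL μ y (hr m) f f')
    (fun m μ y g g' g'' => abs_vh2KerSymAt_le hr hB₂b m μ y g g' g'') m hδ

/-- [folklore] (RS) (TB): block-translation covariance of the symmetrised-brick composite second-order family at blocking `L^m`. -/
theorem compVh2S_rootedSym_translate (hL : 1 ≤ L) (m : ℕ) (κ : Fin (d + 1)) (u : Site (d + 1)) (κ' : Fin (d + 1)) (u' t : Site (d + 1)) :
    compVh2S (fun m => linKerAt (toSite (r m)) L) (fun m => vhKerAt (toSite (r m)) L) (fun m => vh2KerSymAt (toSite (r m)) L) L m κ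
        (u + ((L ^ m : ℕ) : ℤ) • t) κ' (u' + ((L ^ m : ℕ) : ℤ) • t)
      = shiftK (-(((L ^ m : ℕ) : ℤ) • t))
          (compVh2S (fun m => linKerAt (toSite (r m)) L) (fun m => vhKerAt (toSite (r m)) L) (fun m => vh2KerSymAt (toSite (r m)) L) L m κ u κ' u') :=
  compVh2S_translate (ℓ := fun m => linKerAt (toSite (r m)) L) (𝓋 := fun m => vhKerAt (toSite (r m)) L)
    (𝓋₂ := fun m => vh2KerSymAt (toSite (r m)) L) hL
    (fun m μ y t f => AveragingHessianKernelsRooted.linKerAt_add (toSite (r m)) L μ y t f)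
    (fun m μ y t f f' => AveragingHessianKernelsRooted.vhKerAt_add (toSite (r m)) L μ y t f f')
    (fun m μ y t g g' g'' => vh2KerSymAt_add (toSite (r m)) L μ y t g g' g'') m κ u κ' u' t

/-! ## §4 The «SymSym» instantiation: (0.4)-symmetrised bricks at one root, the second brick symmetrised in the two background bonds -/

section SymSym

open Summit.QuantumFields.BalabanUV.Beta.SymAveragingHessianCounts (symLinKerAt symVhKerAt)
open Summit.QuantumFields.BalabanUV.Beta.SymAveragingMixedJetTables (symVh2KerAt symVh₂SAt symVh2Abs symVh2Abs_nonneg)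

/-- [our object — bookkeeping] **THE (0.4)-SYMMETRISED SECOND BRICK SYMMETRISED IN THE TWO BACKGROUND BONDS**:
`symVh2KerSymAt ρ L μ y g g₁ g₂ := ½ (symVh2KerAt ρ L μ y g g₁ g₂ + symVh2KerAt ρ L μ y g g₂ g₁)` — the sym twin of `vh2KerSymAt`. -/
def symVh2KerSymAt (ρ : Site (d + 1)) (L : ℕ) (μ : Fin (d + 1)) (y : Site (d + 1)) (g g₁ g₂ : Bond (d + 1)) : ℝ :=
  (1 / 2 : ℝ) * (symVh2KerAt ρ L μ y g g₁ g₂ + symVh2KerAt ρ L μ y g g₂ g₁)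

/-- [folklore] unfolding. -/
theorem symVh2KerSymAt_apply (ρ : Site (d + 1)) (L : ℕ) (μ : Fin (d + 1)) (y : Site (d + 1)) (g g₁ g₂ : Bond (d + 1)) :
    symVh2KerSymAt ρ L μ y g g₁ g₂ = (1 / 2 : ℝ) * (symVh2KerAt ρ L μ y g g₁ g₂ + symVh2KerAt ρ L μ y g g₂ g₁) := rfl

/-- [folklore] symmetry in the two background bonds. -/
theorem symVh2KerSymAt_swap (ρ : Site (d + 1)) (L : ℕ) (μ : Fin (d + 1)) (y : Site (d + 1)) (g g₁ g₂ : Bond (d + 1)) :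
    symVh2KerSymAt ρ L μ y g g₂ g₁ = symVh2KerSymAt ρ L μ y g g₁ g₂ := by
  rw [symVh2KerSymAt, symVh2KerSymAt, add_comm]

variable {rₛ : Fin (d + 1) → ℕ}

/-- [folklore] support in the fluctuation bond (box root). -/
theorem symVh2KerSymAt_eq_zero₁ (hr : rₛ ∈ box (d + 1) L) (μ : Fin (d + 1)) (y : Site (d + 1)) {g : Bond (d + 1)}
    (h : ¬ Near L y g.2) (g₁ g₂ : Bond (d + 1)) : symVh2KerSymAt (toSite rₛ) L μ y g g₁ g₂ = 0 := by
  have e1 : symVh2KerAt (toSite rₛ) L μ y g g₁ g₂ = 0 := by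
    show ((SymAveragingMixedJetTables.symVh2Tab (toSite rₛ) L μ y g g₁ g₂ : ℚ) : ℝ) = 0
    rw [SymAveragingMixedJetTables.symVh2Tab_eq_zero₁ hr μ y h g₁ g₂, Rat.cast_zero]
  have e2 : symVh2KerAt (toSite rₛ) L μ y g g₂ g₁ = 0 := by
    show ((SymAveragingMixedJetTables.symVh2Tab (toSite rₛ) L μ y g g₂ g₁ : ℚ) : ℝ) = 0
    rw [SymAveragingMixedJetTables.symVh2Tab_eq_zero₁ hr μ y h g₂ g₁, Rat.cast_zero]
  rw [symVh2KerSymAt, e1, e2, add_zero, mul_zero]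

/-- [folklore] support in the first background bond (box root). -/
theorem symVh2KerSymAt_eq_zero₂ (hr : rₛ ∈ box (d + 1) L) (μ : Fin (d + 1)) (y : Site (d + 1)) (g : Bond (d + 1)) {g₁ : Bond (d + 1)}
    (h : ¬ Near L y g₁.2) (g₂ : Bond (d + 1)) : symVh2KerSymAt (toSite rₛ) L μ y g g₁ g₂ = 0 := by
  have e1 : symVh2KerAt (toSite rₛ) L μ y g g₁ g₂ = 0 := by
    show ((SymAveragingMixedJetTables.symVh2Tab (toSite rₛ) L μ y g g₁ g₂ : ℚ) : ℝ) = 0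
    rw [SymAveragingMixedJetTables.symVh2Tab_eq_zero₂ hr μ y g h g₂, Rat.cast_zero]
  have e2 : symVh2KerAt (toSite rₛ) L μ y g g₂ g₁ = 0 := by
    show ((SymAveragingMixedJetTables.symVh2Tab (toSite rₛ) L μ y g g₂ g₁ : ℚ) : ℝ) = 0
    rw [SymAveragingMixedJetTables.symVh2Tab_eq_zero₃ hr μ y g g₂ h, Rat.cast_zero]
  rw [symVh2KerSymAt, e1, e2, add_zero, mul_zero]

/-- [folklore] support in the second background bond (box root). -/
theorem symVh2KerSymAt_eq_zero₃ (hr : rₛ ∈ box (d + 1) L) (μ : Fin (d + 1)) (y : Site (d + 1)) (g g₁ : Bond (d + 1)) {g₂ : Bond (d + 1)}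
    (h : ¬ Near L y g₂.2) : symVh2KerSymAt (toSite rₛ) L μ y g g₁ g₂ = 0 := by
  rw [← symVh2KerSymAt_swap]
  exact symVh2KerSymAt_eq_zero₂ hr μ y g h g₁

/-- [folklore] the bound: `|𝓋₂^{ss}| ≤ symVh2Abs (toSite rₛ) L` (an1's `abs_symVh2Tab_le` twice; ONE root — no uniformity hypothesis). -/
theorem abs_symVh2KerSymAt_le (hr : rₛ ∈ box (d + 1) L) (μ : Fin (d + 1)) (y : Site (d + 1)) (g g₁ g₂ : Bond (d + 1)) :
    |symVh2KerSymAt (toSite rₛ) L μ y g g₁ g₂| ≤ symVh2Abs (toSite rₛ) L := by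
  have e1 : |symVh2KerAt (toSite rₛ) L μ y g g₁ g₂| ≤ symVh2Abs (toSite rₛ) L := SymAveragingMixedJetTables.abs_symVh2Tab_le hr μ y g g₁ g₂
  have e2 : |symVh2KerAt (toSite rₛ) L μ y g g₂ g₁| ≤ symVh2Abs (toSite rₛ) L := SymAveragingMixedJetTables.abs_symVh2Tab_le hr μ y g g₂ g₁
  rw [symVh2KerSymAt, abs_mul, abs_of_pos (by norm_num : (0 : ℝ) < 1 / 2)]
  have h3 := abs_add_le (symVh2KerAt (toSite rₛ) L μ y g g₁ g₂) (symVh2KerAt (toSite rₛ) L μ y g g₂ g₁)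
  linarith

/-- [folklore] block covariance of the symmetrised sym brick (an1's `symVh2KerAt_add` twice). -/
theorem symVh2KerSymAt_add (ρ : Site (d + 1)) (L : ℕ) (μ : Fin (d + 1)) (y t : Site (d + 1)) (g g₁ g₂ : Bond (d + 1)) :
    symVh2KerSymAt ρ L μ (y + t) (g.sh ((L : ℤ) • t)) (g₁.sh ((L : ℤ) • t)) (g₂.sh ((L : ℤ) • t)) = symVh2KerSymAt ρ L μ y g g₁ g₂ := by
  rw [symVh2KerSymAt, symVh2KerSymAt, SymAveragingMixedJetTables.symVh2KerAt_add, SymAveragingMixedJetTables.symVh2KerAt_add]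

/-- [folklore] (SS) ANCHOR: over an1's (0.4)-symmetrised bricks at one root with the second brick symmetrised, the depth-one composite second-order border kernel
IS the symmetrised sym brick. -/
theorem compVH2Ker_symSym_one (hr : rₛ ∈ box (d + 1) L) (μ : Fin (d + 1)) (y : Site (d + 1)) (f b b' : Bond (d + 1)) :
    compVH2Ker (fun _ => symLinKerAt (toSite rₛ) L) (fun _ => symVhKerAt (toSite rₛ) L) (fun _ => symVh2KerSymAt (toSite rₛ) L) L 1 μ y f b b'
      = symVh2KerSymAt (toSite rₛ) L μ y f b b' :=
  compVH2Ker_one (fun _ μ y _ g' g'' h => symVh2KerSymAt_eq_zero₁ hr μ y h g' g'')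
    (fun _ μ y g _ g'' h => symVh2KerSymAt_eq_zero₂ hr μ y g h g'') (fun _ μ y g g' _ h => symVh2KerSymAt_eq_zero₃ hr μ y g g' h) μ y f b b'

/-- [folklore] **(SS) ANCHOR AT THE STENCIL LEVEL**: the depth-one packed family IS `½ • (symVh₂SAt (toSite rₛ) L κ u κ′ u′ + symVh₂SAt (toSite rₛ) L κ′ u′ κ u)` — the (0.4)
record's row table `SymSecondOrderTablesAn1.symVh₂SAn1 d L` is `atw` of exactly this at `toSite rₛ = ctr (d+1) L`. -/
theorem compVh2S_symSym_one (hr : rₛ ∈ box (d + 1) L) (κ : Fin (d + 1)) (u : Site (d + 1)) (κ' : Fin (d + 1)) (u' : Site (d + 1)) :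
    compVh2S (fun _ => symLinKerAt (toSite rₛ) L) (fun _ => symVhKerAt (toSite rₛ) L) (fun _ => symVh2KerSymAt (toSite rₛ) L) L 1 κ u κ' u'
      = (1 / 2 : ℝ) • (symVh₂SAt (toSite rₛ) L κ u κ' u' + symVh₂SAt (toSite rₛ) L κ' u' κ u) := by
  funext x z a b
  have e : ∀ (μ : Fin (d + 1)) (y : Site (d + 1)) (f f' : Bond (d + 1)),
      compVH2Ker (fun _ => symLinKerAt (toSite rₛ) L) (fun _ => symVhKerAt (toSite rₛ) L) (fun _ => symVh2KerSymAt (toSite rₛ) L) L 1 μ y f (κ, u) f'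
        = (1 / 2 : ℝ) * (symVh2KerAt (toSite rₛ) L μ y f (κ, u) f' + symVh2KerAt (toSite rₛ) L μ y f f' (κ, u)) :=
    fun μ y f f' => compVH2Ker_symSym_one hr μ y f (κ, u) f'
  simp only [compVh2S, pow_one, Pi.smul_apply, Pi.add_apply, smul_eq_mul, SymAveragingMixedJetTables.symVh₂SAt]
  rcases a with α | μ <;> rcases b with α' | μ'
  · simp only [AveragingHessianKernels.packVH_inl_inl, add_zero, mul_zero]
  · simp only [AveragingHessianKernels.packVH_inl_inr]
    split_ifs with h
    · exact e μ' (blk L z) (α, x) (κ', u')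
    · rw [add_zero, mul_zero]
  · simp only [AveragingHessianKernels.packVH_inr_inl]
    split_ifs with h
    · exact e μ (blk L x) (α', z) (κ', u')
    · rw [add_zero, mul_zero]
  · simp only [AveragingHessianKernels.packVH_inr_inr, add_zero, mul_zero]

/-- [folklore] (SS) (LB): the sym composite second-order family with the symmetrised second brick at blocking `L^m` has the `LocStencil₂` body at every rate,
constant `bndVH2 … (symVh2Abs (toSite rₛ) L) m · e^{3(d+1)·wid m·δ}`. -/
theorem locStencil₂_compVh2S_symSym (hL : 1 ≤ L) (hr : rₛ ∈ box (d + 1) L) (m : ℕ) {δ : ℝ} (hδ : 0 ≤ δ) :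
    LocStencil₂ (compVh2S (fun _ => symLinKerAt (toSite rₛ) L) (fun _ => symVhKerAt (toSite rₛ) L) (fun _ => symVh2KerSymAt (toSite rₛ) L) L m)
      (bndVH2 d L (ell (d + 1) L : ℝ) (3 * (ell (d + 1) L : ℝ) ^ 2) (symVh2Abs (toSite rₛ) L) m * Real.exp (3 * ((d : ℝ) + 1) * (wid L m) * δ)) δ :=
  locStencil₂_compVh2S (ℓ := fun _ => symLinKerAt (toSite rₛ) L) (𝓋 := fun _ => symVhKerAt (toSite rₛ) L)
    (𝓋₂ := fun _ => symVh2KerSymAt (toSite rₛ) L) hL (by positivity) (by positivity) (symVh2Abs_nonneg _ L)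
    (fun _ μ y f => SymAveragingHessianCounts.abs_symLinKerAt_le hL μ y hr f)
    (fun _ μ y f f' => SymAveragingHessianCounts.abs_symVhKerAt_le hL μ y hr f f')
    (fun _ μ y g g' g'' => abs_symVh2KerSymAt_le hr μ y g g' g'') m hδ

/-- [folklore] (SS) (TB): block-translation covariance at blocking `L^m`. -/
theorem compVh2S_symSym_translate {ρ : Site (d + 1)} (hL : 1 ≤ L) (m : ℕ) (κ : Fin (d + 1)) (u : Site (d + 1)) (κ' : Fin (d + 1))
    (u' t : Site (d + 1)) :
    compVh2S (fun _ => symLinKerAt ρ L) (fun _ => symVhKerAt ρ L) (fun _ => symVh2KerSymAt ρ L) L m κ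
        (u + ((L ^ m : ℕ) : ℤ) • t) κ' (u' + ((L ^ m : ℕ) : ℤ) • t)
      = shiftK (-(((L ^ m : ℕ) : ℤ) • t))
          (compVh2S (fun _ => symLinKerAt ρ L) (fun _ => symVhKerAt ρ L) (fun _ => symVh2KerSymAt ρ L) L m κ u κ' u') :=
  compVh2S_translate (ℓ := fun _ => symLinKerAt ρ L) (𝓋 := fun _ => symVhKerAt ρ L) (𝓋₂ := fun _ => symVh2KerSymAt ρ L) hL
    (fun _ μ y t f => SymAveragingHessianCounts.symLinKerAt_add ρ L μ y t f)
    (fun _ μ y t f f' => SymAveragingHessianCounts.symVhKerAt_add ρ L μ y t f f')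
    (fun _ μ y t g g' g'' => symVh2KerSymAt_add ρ L μ y t g g' g'') m κ u κ' u' t

end SymSym

end Summit.QuantumFields.BalabanUV.Beta.CompositeVertexKernelBoundsTwoSym

end
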